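import Summits.ValiantsHypothesis.ValiantsHypothesis.Theorems.SummationBitsPositiveWitnessBoundCount
import Summits.ValiantsHypothesis.ValiantsHypothesis.Theses.SummationBits
import Literature.Computability.AlgebraicComplexity.DepthReductionProofs

/-!
# ValiantsHypothesis / SummationBits — `PositiveWitnessBound` (Theorem A, upper bound)

Settles item `stmt-ValiantsHypothesis-10488` of route `SummationBits`: for every `c` there is
`C` (here `C = 8c + 40`) such that every `g ∈ ℝ≥0[x_{ij}]` computed by a fan-in-two circuit over
the semiring `ℝ≥0` of size `≤ n^c + c`, with `supp g ⊆ supp per_n`, has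
`|supp g| ≤ 2^(n·log₂log₂ n + C·n)`.

Proof. Extract a straight-line program (`DepthReduction.exists_slp`), homogenize it in degree
`n` (`SLP.homogenize`; `g` is homogeneous of degree `n`, being supported on permutation
monomials), and count supports along the `×`-balanced gate-quotient expansion
(`PositiveWitness.card_support_aval_le` of the companion file `…Count.lean`) with the cut
`D₀ = ⌊log₂ n⌋`: `|supp g| ≤ (#nodes²)^(2n/D₀) · D₀^n`, `#nodes ≤ 4 s (n+1)²`. The arithmetic
`(#nodes²)^(2n/D₀) ≤ 2^((8c+40)·n)` and `D₀^n ≤ (log₂ n)^n = 2^(n·log₂log₂ n)` finishes; `n ≤ 3`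
is checked directly (`|supp g| ≤ n! ≤ 2^(C n)`). The plainness hypothesis on the sum gates is not
used (over `ℝ≥0` every circuit is monotone). [cite: JerrumSnir1982, §4.3]
-/

namespace Summit.ValiantsHypothesis.ValiantsHypothesis.Theorems

-- every Theorems file of this summit lives in `Summit.ValiantsHypothesis.ValiantsHypothesis.…`
-- (summit = problem name), which core's `dupNamespace` linter reports on each declaration
set_option linter.dupNamespace false

namespace PositiveWitness

open MvPolynomial Literature.Computability.AlgebraicComplexity
open Literature.Computability.AlgebraicComplexity.DepthReduction
open Literature.Barriers.ValiantsHypothesis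
open scoped NNReal

/-! ### Size arithmetic -/

/-- The number of nodes of the homogenized program, squared, is `≤ 2^((D₀+1)(2c+10))` when the
program has `≤ n^c + c` lines and `n < 2^(D₀+1)`. [folklore] -/
theorem nodes_sq_le {N s n c D₀ : ℕ} (hN : N ≤ 4 * s * (n + 1) ^ 2) (hs : s ≤ n ^ c + c)
    (hn : n < 2 ^ (D₀ + 1)) : N * N ≤ 2 ^ ((D₀ + 1) * (2 * c + 10)) := by
  set T := 2 ^ (D₀ + 1) with hT
  have hT2 : 2 ≤ T := by
    calc (2 : ℕ) = 2 ^ 1 := rfl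
      _ ≤ 2 ^ (D₀ + 1) := Nat.pow_le_pow_right (by norm_num) (by omega)
  have h1 : n + 1 ≤ T := hn
  have h2 : n ^ c ≤ T ^ c := Nat.pow_le_pow_left (by omega) c
  have h3 : c ≤ T ^ c := (Nat.lt_two_pow_self).le.trans (Nat.pow_le_pow_left hT2 c)
  have h4 : s ≤ 2 * T ^ c := by omega
  have h5 : (n + 1) ^ 2 ≤ T ^ 2 := Nat.pow_le_pow_left h1 2
  have h6 : N ≤ 8 * T ^ (c + 2) :=
    calc N ≤ 4 * s * (n + 1) ^ 2 := hN
      _ ≤ 4 * (2 * T ^ c) * T ^ 2 := Nat.mul_le_mul (Nat.mul_le_mul_left 4 h4) h5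
      _ = 8 * T ^ (c + 2) := by ring
  have h8 : 64 ≤ T ^ 6 :=
    calc (64 : ℕ) = 2 ^ 6 := rfl
      _ ≤ T ^ 6 := Nat.pow_le_pow_left hT2 6
  calc N * N ≤ (8 * T ^ (c + 2)) * (8 * T ^ (c + 2)) := Nat.mul_le_mul h6 h6
    _ = 64 * T ^ (2 * c + 4) := by ring
    _ ≤ T ^ 6 * T ^ (2 * c + 4) := Nat.mul_le_mul_right _ h8
    _ = T ^ (2 * c + 10) := by ring
    _ = 2 ^ ((D₀ + 1) * (2 * c + 10)) := by rw [pow_mul]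

/-- Exponent bookkeeping: `(D₀+1)·K·⌊2n/D₀⌋ ≤ 4·K·n` for `D₀ ≥ 1`. [folklore] -/
theorem exp_le {n D₀ : ℕ} (hD₀ : 1 ≤ D₀) (K : ℕ) :
    (D₀ + 1) * K * (2 * n / D₀) ≤ 4 * K * n := by
  have h1 : D₀ * (2 * n / D₀) ≤ 2 * n := Nat.mul_div_le (2 * n) D₀
  have h2 : (D₀ + 1) * (2 * n / D₀) ≤ 4 * n :=
    calc (D₀ + 1) * (2 * n / D₀) ≤ (2 * D₀) * (2 * n / D₀) := Nat.mul_le_mul_right _ (by omega)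
      _ = 2 * (D₀ * (2 * n / D₀)) := by ring
      _ ≤ 2 * (2 * n) := Nat.mul_le_mul_left 2 h1
      _ = 4 * n := by ring
  calc (D₀ + 1) * K * (2 * n / D₀) = K * ((D₀ + 1) * (2 * n / D₀)) := by ring
    _ ≤ K * (4 * n) := Nat.mul_le_mul_left K h2
    _ = 4 * K * n := by ring

/-! ### The bound in natural numbers -/

/-- **Theorem A, counting form.** For `n ≥ 4`, a polynomial `g` over `ℝ≥0` with
`supp g ⊆ supp per_n` computed by a fan-in-two circuit of size `≤ n^c + c` has at most
`2^((8c+40)·n) · ⌊log₂ n⌋^n` monomials. [cite: JerrumSnir1982, §4.3] -/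
theorem card_support_le_two_pow_mul {n c : ℕ} (hn : 4 ≤ n)
    {P : ArithCircuit ℝ≥0 (Fin n × Fin n)} {g : MvPolynomial (Fin n × Fin n) ℝ≥0}
    (hP : P.IsFanInTwo) (hg : P.Computes g) (hsize : P.size ≤ n ^ c + c)
    (hsupp : g.support ⊆ (perPoly (Fin n) ℝ≥0).support) :
    g.support.card ≤ 2 ^ ((8 * c + 40) * n) * (Nat.log 2 n) ^ n := by
  classical
  set D₀ := Nat.log 2 n with hD₀def
  have hD₀2 : 2 ≤ D₀ := Nat.le_log_of_pow_le one_lt_two (by norm_num; omega)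
  have hD₀1 : 1 ≤ D₀ := by omega
  have hD₀n : D₀ < n := Nat.log_lt_self 2 (by omega)
  have hnlt : n < 2 ^ (D₀ + 1) := Nat.lt_pow_succ_log_self one_lt_two n
  have hR : 1 ≤ 2 ^ ((8 * c + 40) * n) * D₀ ^ n :=
    Nat.one_le_iff_ne_zero.2 (Nat.mul_ne_zero (pow_ne_zero _ (by norm_num)) (pow_ne_zero _ (by omega)))
  obtain ⟨S, hlen, hcase⟩ := exists_slp P hP
  unfold ArithCircuit.Computes at hg
  rcases hcase with ⟨i, hi, hval⟩ | ⟨j, hj⟩ | ⟨c', hc'⟩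
  rotate_left
  · -- `g` is a variable
    rw [← hg, hj, support_X, Finset.card_singleton]
    exact hR
  · -- `g` is a constant
    rw [← hg, hc', C_apply]
    refine ((Finset.card_le_card support_monomial_subset).trans ?_).trans hR
    simp
  -- the main case: `g` is the value of line `i`; homogenize in degree `n`
  set H := S.homogenize n with hH
  let α : S.Node n := (⟨i, hi⟩, SLP.Tag.Q (Fin.last n))
  have hhom : g.IsHomogeneous n := by
    intro d hd
    have hd' : d ∈ (perPoly (Fin n) ℝ≥0).support := hsupp (mem_support_iff.2 hd)
    have := perPoly_isHomogeneous (n := Fin n) (k := ℝ≥0) (mem_support_iff.1 hd')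
    simpa using this
  have hvalα : H.val α = g := by
    change S.hval n (⟨i, hi⟩, SLP.Tag.Q (Fin.last n)) = g
    rw [SLP.hval_Q]
    change homogeneousComponent n (S.val i) = g
    rw [← hval, hg]
    exact homogeneousComponent_eq_self hhom
  have hdegα : H.adeg (.node α) = n := rfl
  have key := card_support_aval_le H hD₀1 n (.node α) hdegα
    ⟨0, fun m hm => by
      rw [add_zero]
      rw [HomCircuit.aval_node, hvalα] at hm
      exact hsupp hm⟩
  rw [HomCircuit.aval_node, hvalα, if_neg (not_le.2 hD₀n)] at key
  refine key.trans (Nat.mul_le_mul_right _ ?_)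
  -- `(#nodes²)^(2n/D₀ - 1) ≤ 2^((8c+40) n)`
  have hN : Fintype.card (S.Node n) ≤ 4 * S.len * (n + 1) ^ 2 := S.card_node_le n
  rw [← hlen] at hsize
  have hNN := nodes_sq_le hN hsize hnlt
  have hN1 : 1 ≤ Fintype.card (S.Node n) * Fintype.card (S.Node n) := by
    have : 1 ≤ Fintype.card (S.Node n) := Fintype.card_pos_iff.2 ⟨α⟩
    exact Nat.one_le_iff_ne_zero.2 (Nat.mul_ne_zero (by omega) (by omega))
  calc (Fintype.card (S.Node n) * Fintype.card (S.Node n)) ^ (2 * n / D₀ - 1)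
      ≤ (Fintype.card (S.Node n) * Fintype.card (S.Node n)) ^ (2 * n / D₀) :=
        Nat.pow_le_pow_right hN1 (Nat.sub_le _ _)
    _ ≤ (2 ^ ((D₀ + 1) * (2 * c + 10))) ^ (2 * n / D₀) := Nat.pow_le_pow_left hNN _
    _ = 2 ^ ((D₀ + 1) * (2 * c + 10) * (2 * n / D₀)) := by rw [← pow_mul]
    _ ≤ 2 ^ (4 * (2 * c + 10) * n) := Nat.pow_le_pow_right (by norm_num) (exp_le hD₀1 _)
    _ = 2 ^ ((8 * c + 40) * n) := by ring_nf

/-! ### Real-number bookkeeping -/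

/-- The exponent `n · log₂ log₂ n` is nonnegative for every natural `n` (with Lean's
`log₂ 0 = 0`). [folklore] -/
theorem exponent_nonneg (n : ℕ) : 0 ≤ (n : ℝ) * Real.logb 2 (Real.logb 2 (n : ℝ)) := by
  rcases Nat.lt_or_ge n 2 with hn | hn
  · interval_cases n
    · simp
    · simp [Real.logb_one, Real.logb_zero]
  · apply mul_nonneg (Nat.cast_nonneg n)
    apply Real.logb_nonneg one_lt_two
    rw [Real.le_logb_iff_rpow_le one_lt_two (by positivity), Real.rpow_one]
    exact_mod_cast hn

/-- `⌊log₂ n⌋^n ≤ 2^(n · log₂ log₂ n)` for `n ≥ 4`. [folklore] -/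
theorem log_pow_le {n : ℕ} (hn : 4 ≤ n) :
    ((Nat.log 2 n : ℕ) : ℝ) ^ n ≤ (2 : ℝ) ^ ((n : ℝ) * Real.logb 2 (Real.logb 2 (n : ℝ))) := by
  set ℓ := Real.logb 2 (n : ℝ) with hℓ
  have hn0 : (0 : ℝ) < n := by positivity
  have hℓpos : 0 < ℓ := Real.logb_pos one_lt_two (by exact_mod_cast (show 1 < n by omega))
  have hD : ((Nat.log 2 n : ℕ) : ℝ) ≤ ℓ := by
    rw [hℓ, Real.le_logb_iff_rpow_le one_lt_two hn0, Real.rpow_natCast]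
    exact_mod_cast Nat.pow_log_le_self 2 (by omega : n ≠ 0)
  calc ((Nat.log 2 n : ℕ) : ℝ) ^ n ≤ ℓ ^ n := pow_le_pow_left₀ (Nat.cast_nonneg _) hD n
    _ = ((2 : ℝ) ^ (Real.logb 2 ℓ)) ^ n := by rw [Real.rpow_logb two_pos (by norm_num) hℓpos]
    _ = (2 : ℝ) ^ (Real.logb 2 ℓ * n) := by rw [Real.rpow_mul (by norm_num), Real.rpow_natCast]
    _ = (2 : ℝ) ^ ((n : ℝ) * Real.logb 2 ℓ) := by rw [mul_comm]

/-- **Theorem A (upper bound), real form with the constant `C = 8c + 40`.** [cite: JerrumSnir1982, §4.3] -/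
theorem card_support_le_rpow {n c : ℕ} {P : ArithCircuit ℝ≥0 (Fin n × Fin n)}
    {g : MvPolynomial (Fin n × Fin n) ℝ≥0} (hP : P.IsFanInTwo) (hg : P.Computes g)
    (hsize : P.size ≤ n ^ c + c) (hsupp : g.support ⊆ (perPoly (Fin n) ℝ≥0).support) :
    (g.support.card : ℝ) ≤
      (2 : ℝ) ^ ((n : ℝ) * Real.logb 2 (Real.logb 2 (n : ℝ)) + ((8 * c + 40 : ℕ) : ℝ) * n) := by
  have hcast : ∀ k : ℕ, ((2 ^ ((8 * c + 40) * k) : ℕ) : ℝ) =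
      (2 : ℝ) ^ (((8 * c + 40 : ℕ) : ℝ) * (k : ℝ)) := by
    intro k
    rw [← Nat.cast_mul, Real.rpow_natCast]
    push_cast
    ring
  have hmain : (g.support.card : ℝ) ≤ (2 : ℝ) ^ (((8 * c + 40 : ℕ) : ℝ) * (n : ℝ)) *
      (2 : ℝ) ^ ((n : ℝ) * Real.logb 2 (Real.logb 2 (n : ℝ))) := by
    rcases Nat.lt_or_ge n 4 with hn | hn
    · -- small `n`: `|supp g| ≤ n! ≤ 2^(C n)`
      have h1 : g.support.card ≤ 2 ^ ((8 * c + 40) * n) := by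
        have hle : g.support.card ≤ n.factorial :=
          (Finset.card_le_card hsupp).trans (JerrumSnir.card_support_perPoly ℝ≥0).le
        refine hle.trans ?_
        interval_cases n
        · simp
        · simp [Nat.one_le_two_pow]
        · calc (2 : ℕ).factorial = 2 ^ 1 := rfl
            _ ≤ _ := Nat.pow_le_pow_right (by norm_num) (by omega)
        · calc (3 : ℕ).factorial ≤ 2 ^ 3 := by decide
            _ ≤ _ := Nat.pow_le_pow_right (by norm_num) (by omega)
      have h2 : (1 : ℝ) ≤ (2 : ℝ) ^ ((n : ℝ) * Real.logb 2 (Real.logb 2 (n : ℝ))) :=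
        Real.one_le_rpow (by norm_num) (exponent_nonneg n)
      calc (g.support.card : ℝ) ≤ ((2 ^ ((8 * c + 40) * n) : ℕ) : ℝ) := by exact_mod_cast h1
        _ = (2 : ℝ) ^ (((8 * c + 40 : ℕ) : ℝ) * (n : ℝ)) * 1 := by rw [hcast, mul_one]
        _ ≤ _ := mul_le_mul_of_nonneg_left h2 (by positivity)
    · have h1 := card_support_le_two_pow_mul hn hP hg hsize hsupp
      have h2 := log_pow_le hn
      calc (g.support.card : ℝ)
          ≤ ((2 ^ ((8 * c + 40) * n) * (Nat.log 2 n) ^ n : ℕ) : ℝ) := by exact_mod_cast h1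
        _ = (2 : ℝ) ^ (((8 * c + 40 : ℕ) : ℝ) * (n : ℝ)) * (((Nat.log 2 n : ℕ) : ℝ) ^ n) := by
            rw [Nat.cast_mul, hcast, Nat.cast_pow]
        _ ≤ _ := mul_le_mul_of_nonneg_left h2 (by positivity)
  exact hmain.trans_eq ((mul_comm _ _).trans (Real.rpow_add two_pos _ _).symm)

end PositiveWitness

/-- **Settles `stmt-ValiantsHypothesis-10488` (`PositiveWitnessBound`, Theorem A of the card,
upper bound).** For every `c` there is `C` (`= 8c + 40`) such that every `g ∈ ℝ≥0[x]` with a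
Jerrum–Snir monotone computation of size `≤ n^c + c` and `supp g ⊆ supp per_n` has
`|supp g| ≤ 2^(n·log₂log₂n + C·n)`. [cite: JerrumSnir1982, §4.3] -/
theorem positiveWitnessBound_proof :
    Summit.ValiantsHypothesis.ValiantsHypothesis.Theses.SummationBits.PositiveWitnessBound := by
  unfold Summit.ValiantsHypothesis.ValiantsHypothesis.Theses.SummationBits.PositiveWitnessBound
  intro c
  refine ⟨8 * c + 40, ?_⟩
  intro n P g hP hsize hsupp
  exact PositiveWitness.card_support_le_rpow hP.1 hP.2.2 hsize hsupp

end Summit.ValiantsHypothesis.ValiantsHypothesis.Theorems
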